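import Mathlib.GroupTheory.Nilpotent
import Mathlib.GroupTheory.FreeGroup.Basic
import Mathlib.LinearAlgebra.Matrix.Notation
import Mathlib.Data.Matrix.Mul
import HarnessLib

/-!
# Stub `stub_magnusWittRead` of line `saturated-torsor-descent` for crux
`CongruenceShadows.NilpotentShadowsStandard` (item stmt-SmoothPoincare4-14594)

**Magnus–Witt in degrees `≤ 3` for `F = FreeGroup (Fin n)`, reading form** (`INJ2 ∧ READ`, see
`stub_magnusWittRead`).  Proof (elementary): (1) in `F ⧸ γ₃` commutators are central, so
`⁅·,·⁆` is bimultiplicative there and every element of `γ₂` is a pair product `PP(m)` modulo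
`γ₃` (`gen_two`); (2) the representations `y_i ↦ 1 + α i • E₁₂ + β i • E₂₃ + γ i • E₃₄` into
upper unitriangular `4 × 4` integer matrices send `γ₂ / γ₃ / γ₄` to matrices with zero first
superdiagonal / corner matrices / `1`, their `(0,2)`, `(1,3)` entries are additive on `γ₂` and
read the pairings `Σ_{v<w} m v w (α v β w - α w β v)` of the coordinates (`INJ2`), and the
corner of `⁅η⁻¹, y_j⁆` is `α j · (1,3)(η) - (0,2)(η) · γ j`; (3) with coordinate vectors
`δ_p, δ_q, δ_r` the relation gives `s p · M p q r = s r · M r p q` for the antisymmetrised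
coordinates `M`, so `D j = s j • M j` is alternating and `η j ≡ PP(m j) = PP(s j • D j)`.
Mathlib only; no definitions, no named facts.
-/

-- the prescribed namespace `Summit.<P>.<Sub>.…` duplicates `SmoothPoincare4` (P = Sub)
set_option linter.dupNamespace false

open Subgroup
open scoped commutatorElement

namespace Summit.SmoothPoincare4.SmoothPoincare4.Theorems.NilpotentShadowsStandard.SaturatedTorsorDescent

/-- Product of two upper unitriangular `4 × 4` integer matrices in coordinates. [folklore] -/
private theorem umul (a b c d e f a' b' c' d' e' f' : ℤ) :
    !![1, a, b, c; 0, 1, d, e; 0, 0, 1, f; 0, 0, 0, (1 : ℤ)] *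
      !![1, a', b', c'; 0, 1, d', e'; 0, 0, 1, f'; 0, 0, 0, (1 : ℤ)] =
    !![1, a + a', b + b' + a * d', c + c' + a * e' + b * f'; 0, 1, d + d', e + e' + d * f';
      0, 0, 1, f + f'; 0, 0, 0, (1 : ℤ)] := by
  ext i j; fin_cases i <;> fin_cases j <;> simp [Matrix.mul_apply, Fin.sum_univ_four] <;> ring

/-- Coordinatewise equality of upper unitriangular matrices. [folklore] -/
private theorem uext {a b c d e f a' b' c' d' e' f' : ℤ} (h₁ : a = a') (h₂ : b = b') (h₃ : c = c')
    (h₄ : d = d') (h₅ : e = e') (h₆ : f = f') :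
    !![1, a, b, c; 0, 1, d, e; 0, 0, 1, f; 0, 0, 0, (1 : ℤ)] =
      !![1, a', b', c'; 0, 1, d', e'; 0, 0, 1, f'; 0, 0, 0, (1 : ℤ)] := by subst h₁ h₂ h₃ h₄ h₅ h₆; rfl

/-- The identity matrix in unitriangular coordinates. [folklore] -/
private theorem uone : (1 : Matrix (Fin 4) (Fin 4) ℤ) =
    !![1, 0, 0, 0; 0, 1, 0, 0; 0, 0, 1, 0; 0, 0, 0, (1 : ℤ)] := by decide

/-- Inverse of a unitriangular unit in coordinates. [folklore] -/
private theorem uinv {x : (Matrix (Fin 4) (Fin 4) ℤ)ˣ} {a b c d e f : ℤ}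
    (hx : x.val = !![1, a, b, c; 0, 1, d, e; 0, 0, 1, f; 0, 0, 0, (1 : ℤ)]) :
    (x⁻¹).val = !![1, -a, -b + a * d, -c + a * e + b * f - a * d * f; 0, 1, -d, -e + d * f;
      0, 0, 1, -f; 0, 0, 0, (1 : ℤ)] :=
  Units.inv_eq_of_mul_eq_one_right (by
    rw [hx, umul, uone]; exact uext (by ring) (by ring) (by ring) (by ring) (by ring) (by ring))

/-- Commutator of unitriangular units: level one dies, level two is the pairing. [folklore] -/
private theorem ucomm {x y : (Matrix (Fin 4) (Fin 4) ℤ)ˣ} {a b c d e f a' b' c' d' e' f' : ℤ}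
    (hx : x.val = !![1, a, b, c; 0, 1, d, e; 0, 0, 1, f; 0, 0, 0, (1 : ℤ)])
    (hy : y.val = !![1, a', b', c'; 0, 1, d', e'; 0, 0, 1, f'; 0, 0, 0, (1 : ℤ)]) :
    ∃ t : ℤ, (⁅x, y⁆).val =
      !![1, 0, a * d' - a' * d, t; 0, 1, 0, d * f' - d' * f; 0, 0, 1, 0; 0, 0, 0, (1 : ℤ)] :=
  ⟨_, by
    rw [commutatorElement_def, Units.val_mul, Units.val_mul, Units.val_mul, uinv hx, uinv hy, hx,
      hy, umul, umul, umul]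
    exact uext (by ring) (by ring) rfl (by ring) (by ring) (by ring)⟩

/-- `⁅z⁻¹, y⁆` for `z` of the second level: only the corner `a' e - b f'` survives. [folklore] -/
private theorem ucinv {z y : (Matrix (Fin 4) (Fin 4) ℤ)ˣ} {b c e a' b' c' d' e' f' : ℤ}
    (hz : z.val = !![1, 0, b, c; 0, 1, 0, e; 0, 0, 1, 0; 0, 0, 0, (1 : ℤ)])
    (hy : y.val = !![1, a', b', c'; 0, 1, d', e'; 0, 0, 1, f'; 0, 0, 0, (1 : ℤ)]) :
    (⁅z⁻¹, y⁆).val = !![1, 0, 0, a' * e - b * f'; 0, 1, 0, 0; 0, 0, 1, 0; 0, 0, 0, (1 : ℤ)] := by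
  rw [commutatorElement_def, inv_inv, Units.val_mul, Units.val_mul, Units.val_mul, uinv hz, uinv hy,
    hz, hy, umul, umul, umul]
  exact uext (by ring) (by ring) (by ring) (by ring) (by ring) (by ring)

/-- A unitriangular representation kills the first superdiagonal on `γ₂`. [folklore] -/
private theorem lcs_one_shape {G : Type*} [Group G] (φ : G →* (Matrix (Fin 4) (Fin 4) ℤ)ˣ)
    (hφ : ∀ g, ∃ a b c d e f : ℤ, (φ g).val = !![1, a, b, c; 0, 1, d, e; 0, 0, 1, f; 0, 0, 0, (1 : ℤ)])
    {g : G} (hg : g ∈ (⊤ : Subgroup G).lowerCentralSeries 1) :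
    ∃ b c e : ℤ, (φ g).val = !![1, 0, b, c; 0, 1, 0, e; 0, 0, 1, 0; 0, 0, 0, (1 : ℤ)] := by
  rw [Subgroup.mem_lowerCentralSeries_succ_iff] at hg
  induction hg using closure_induction with
  | mem x hx =>
    obtain ⟨p, -, q, -, rfl⟩ := hx
    obtain ⟨a, b, c, d, e, f, hp⟩ := hφ p; obtain ⟨a', b', c', d', e', f', hq⟩ := hφ q
    exact ⟨_, _, _, by rw [map_commutatorElement, (ucomm hp hq).choose_spec]⟩
  | one => exact ⟨0, 0, 0, by rw [map_one, Units.val_one, uone]⟩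
  | mul x y _ _ hx hy =>
    obtain ⟨b, c, e, hx⟩ := hx; obtain ⟨b', c', e', hy⟩ := hy
    exact ⟨_, _, _, by rw [map_mul, Units.val_mul, hx, hy, umul]; exact uext (by ring) rfl rfl (by ring) rfl (by ring)⟩
  | inv x _ hx =>
    obtain ⟨b, c, e, hx⟩ := hx
    exact ⟨_, _, _, by rw [map_inv, uinv hx]; exact uext (by ring) rfl rfl (by ring) rfl (by ring)⟩

/-- A unitriangular representation sends `γ₃` to corner matrices. [folklore] -/
private theorem lcs_two_shape {G : Type*} [Group G] (φ : G →* (Matrix (Fin 4) (Fin 4) ℤ)ˣ)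
    (hφ : ∀ g, ∃ a b c d e f : ℤ, (φ g).val = !![1, a, b, c; 0, 1, d, e; 0, 0, 1, f; 0, 0, 0, (1 : ℤ)])
    {g : G} (hg : g ∈ (⊤ : Subgroup G).lowerCentralSeries 2) :
    ∃ c : ℤ, (φ g).val = !![1, 0, 0, c; 0, 1, 0, 0; 0, 0, 1, 0; 0, 0, 0, (1 : ℤ)] := by
  rw [Subgroup.mem_lowerCentralSeries_succ_iff] at hg
  induction hg using closure_induction with
  | mem x hx =>
    obtain ⟨p, hp, q, -, rfl⟩ := hx
    obtain ⟨b, c, e, hp⟩ := lcs_one_shape φ hφ hp; obtain ⟨a', b', c', d', e', f', hq⟩ := hφ q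
    exact ⟨_, by rw [map_commutatorElement, (ucomm hp hq).choose_spec]; exact uext rfl (by ring) rfl rfl (by ring) rfl⟩
  | one => exact ⟨0, by rw [map_one, Units.val_one, uone]⟩
  | mul x y _ _ hx hy =>
    obtain ⟨c, hx⟩ := hx; obtain ⟨c', hy⟩ := hy
    exact ⟨c + c', by
      rw [map_mul, Units.val_mul, hx, hy, umul]; exact uext (by ring) rfl (by ring) (by ring) rfl (by ring)⟩
  | inv x _ hx =>
    obtain ⟨c, hx⟩ := hx
    exact ⟨-c, by rw [map_inv, uinv hx]; exact uext (by ring) (by ring) (by ring) (by ring) (by ring) (by ring)⟩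

/-- A unitriangular representation kills `γ₄`. [folklore] -/
private theorem lcs_three_shape {G : Type*} [Group G] (φ : G →* (Matrix (Fin 4) (Fin 4) ℤ)ˣ)
    (hφ : ∀ g, ∃ a b c d e f : ℤ, (φ g).val = !![1, a, b, c; 0, 1, d, e; 0, 0, 1, f; 0, 0, 0, (1 : ℤ)])
    {g : G} (hg : g ∈ (⊤ : Subgroup G).lowerCentralSeries 3) : φ g = 1 := by
  rw [Subgroup.mem_lowerCentralSeries_succ_iff] at hg
  induction hg using closure_induction with
  | mem x hx =>
    obtain ⟨p, hp, q, -, rfl⟩ := hx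
    obtain ⟨c, hp'⟩ := lcs_two_shape φ hφ (inv_mem hp); obtain ⟨a', b', c', d', e', f', hq⟩ := hφ q
    rw [← Units.val_eq_one, ← inv_inv p, map_commutatorElement, map_inv, ucinv hp' hq, uone]
    exact uext rfl rfl (by ring) rfl rfl rfl
  | one => exact map_one φ
  | mul x y _ _ hx hy => rw [map_mul, hx, hy, mul_one]
  | inv x _ hx => rw [map_inv, hx, inv_one]

/-- Powers inside the second level: the second superdiagonal is linear. [folklore] -/
private theorem zpow_shape {x : (Matrix (Fin 4) (Fin 4) ℤ)ˣ} {b e : ℤ}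
    (hx : ∃ c : ℤ, x.val = !![1, 0, b, c; 0, 1, 0, e; 0, 0, 1, 0; 0, 0, 0, (1 : ℤ)]) (k : ℤ) :
    ∃ c : ℤ, (x ^ k).val = !![1, 0, k * b, c; 0, 1, 0, k * e; 0, 0, 1, 0; 0, 0, 0, (1 : ℤ)] := by
  obtain ⟨c₀, hx⟩ := hx
  induction k with
  | zero => exact ⟨0, by rw [zpow_zero, Units.val_one, uone]; exact uext rfl (by ring) rfl rfl (by ring) rfl⟩
  | succ k ih => exact ⟨_, by
      rw [zpow_add_one, Units.val_mul, ih.choose_spec, hx, umul]; exact uext rfl (by ring) rfl rfl (by ring) rfl⟩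
  | pred k ih => exact ⟨_, by
      rw [zpow_sub_one, Units.val_mul, ih.choose_spec, uinv hx, umul]; exact uext rfl (by ring) rfl rfl (by ring) rfl⟩

/-- Products inside the second level: the second superdiagonal is additive. [folklore] -/
private theorem prod_shape {G ι : Type*} [Group G] (φ : G →* (Matrix (Fin 4) (Fin 4) ℤ)ˣ)
    (f : ι → G) (B E : ι → ℤ) (l : List ι) (h : ∀ i ∈ l, ∃ c : ℤ,
      (φ (f i)).val = !![1, 0, B i, c; 0, 1, 0, E i; 0, 0, 1, 0; 0, 0, 0, (1 : ℤ)]) :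
    ∃ c : ℤ, (φ (l.map f).prod).val =
      !![1, 0, (l.map B).sum, c; 0, 1, 0, (l.map E).sum; 0, 0, 1, 0; 0, 0, 0, (1 : ℤ)] := by
  induction l with
  | nil => exact ⟨0, by rw [List.map_nil, List.prod_nil, map_one, Units.val_one, uone]; rfl⟩
  | cons i l ih =>
    obtain ⟨c, hc⟩ := h i List.mem_cons_self
    obtain ⟨c', hc'⟩ := ih fun j hj => h j (List.mem_cons_of_mem _ hj)
    exact ⟨_, by
      rw [List.map_cons, List.prod_cons, map_mul, Units.val_mul, hc, hc', umul, List.map_cons,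
        List.sum_cons, List.map_cons, List.sum_cons]
      exact uext (by ring) (by ring) rfl (by ring) (by ring) (by ring)⟩

/-- Products of corner matrices: the corner is additive. [folklore] -/
private theorem prod_corner {G ι : Type*} [Group G] (φ : G →* (Matrix (Fin 4) (Fin 4) ℤ)ˣ)
    (f : ι → G) (C : ι → ℤ) (l : List ι)
    (h : ∀ i ∈ l, (φ (f i)).val = !![1, 0, 0, C i; 0, 1, 0, 0; 0, 0, 1, 0; 0, 0, 0, (1 : ℤ)]) :
    (φ (l.map f).prod).val = !![1, 0, 0, (l.map C).sum; 0, 1, 0, 0; 0, 0, 1, 0; 0, 0, 0, (1 : ℤ)] := by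
  induction l with
  | nil => rw [List.map_nil, List.prod_nil, map_one, Units.val_one, uone]; rfl
  | cons i l ih =>
    rw [List.map_cons, List.prod_cons, map_mul, Units.val_mul, h i List.mem_cons_self,
      ih fun j hj => h j (List.mem_cons_of_mem _ hj), umul, List.map_cons, List.sum_cons]
    exact uext (by ring) (by ring) (by ring) (by ring) (by ring) (by ring)

/-- The representation `y_i ↦ 1 + α i • E₁₂ + β i • E₂₃ + γ i • E₃₄` (unitriangular). [folklore] -/
private theorem rep_exists {n : ℕ} (α β γ : Fin n → ℤ) :
    ∃ φ : FreeGroup (Fin n) →* (Matrix (Fin 4) (Fin 4) ℤ)ˣ,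
      (∀ i, (φ (FreeGroup.of i)).val = !![1, α i, 0, 0; 0, 1, β i, 0; 0, 0, 1, γ i; 0, 0, 0, (1 : ℤ)]) ∧
      ∀ g, ∃ a b c d e f : ℤ, (φ g).val = !![1, a, b, c; 0, 1, d, e; 0, 0, 1, f; 0, 0, 0, (1 : ℤ)] := by
  have hu : ∀ i : Fin n, ∃ x : (Matrix (Fin 4) (Fin 4) ℤ)ˣ,
      x.val = !![1, α i, 0, 0; 0, 1, β i, 0; 0, 0, 1, γ i; 0, 0, 0, (1 : ℤ)] := fun i =>
    ⟨⟨!![1, α i, 0, 0; 0, 1, β i, 0; 0, 0, 1, γ i; 0, 0, 0, (1 : ℤ)],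
      !![1, -α i, α i * β i, -(α i * β i * γ i); 0, 1, -β i, β i * γ i; 0, 0, 1, -γ i; 0, 0, 0, (1 : ℤ)],
      by rw [umul, uone]; exact uext (by ring) (by ring) (by ring) (by ring) (by ring) (by ring),
      by rw [umul, uone]; exact uext (by ring) (by ring) (by ring) (by ring) (by ring) (by ring)⟩, rfl⟩
  choose u hu using hu
  refine ⟨FreeGroup.lift u, fun i => by rw [FreeGroup.lift_apply_of]; exact hu i, fun g => ?_⟩
  induction g with
  | C1 => exact ⟨0, 0, 0, 0, 0, 0, by rw [map_one, Units.val_one, uone]⟩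
  | of i => exact ⟨_, _, _, _, _, _, by rw [FreeGroup.lift_apply_of]; exact hu i⟩
  | inv_of i _ => exact ⟨_, _, _, _, _, _, by rw [map_inv, FreeGroup.lift_apply_of, uinv (hu i)]⟩
  | mul x y hx hy =>
    obtain ⟨a, b, c, d, e, f, hx⟩ := hx; obtain ⟨a', b', c', d', e', f', hy⟩ := hy
    exact ⟨_, _, _, _, _, _, by rw [map_mul, Units.val_mul, hx, hy, umul]⟩

/-- The representation reads the alternating pairings of the pair-product exponents. [folklore] -/
private theorem pp_shape {n : ℕ} (φ : FreeGroup (Fin n) →* (Matrix (Fin 4) (Fin 4) ℤ)ˣ)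
    (α β γ : Fin n → ℤ)
    (hφ : ∀ i, (φ (FreeGroup.of i)).val = !![1, α i, 0, 0; 0, 1, β i, 0; 0, 0, 1, γ i; 0, 0, 0, (1 : ℤ)])
    (m : Fin n → Fin n → ℤ) :
    ∃ c : ℤ, (φ ((List.finRange n).map (fun v => ((List.finRange n).map (fun w =>
      if v < w then ⁅(FreeGroup.of v : FreeGroup (Fin n)), FreeGroup.of w⁆ ^ (m v w)
      else (1 : FreeGroup (Fin n)))).prod)).prod).val =
      !![1, 0, ∑ v, ∑ w, (if v < w then m v w else 0) * (α v * β w - α w * β v), c;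
        0, 1, 0, ∑ v, ∑ w, (if v < w then m v w else 0) * (β v * γ w - β w * γ v);
        0, 0, 1, 0; 0, 0, 0, (1 : ℤ)] := by
  simp only [Fin.sum_univ_def]
  refine prod_shape φ _ _ _ _ fun v _ => prod_shape φ _ _ _ _ fun w _ => ?_
  split_ifs with hvw
  · obtain ⟨t, ht⟩ := ucomm (hφ v) (hφ w)
    obtain ⟨c, hc⟩ := zpow_shape ⟨t, by rw [← map_commutatorElement] at ht; exact ht⟩ (m v w)
    exact ⟨c, by rw [map_zpow, hc]⟩
  · exact ⟨0, by rw [map_one, Units.val_one, uone]; exact uext rfl (by ring) rfl rfl (by ring) rfl⟩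

/-- Evaluating the alternating pairing at coordinate vectors. [folklore] -/
private theorem omega_delta {n : ℕ} (m : Fin n → Fin n → ℤ) (p q : Fin n) :
    (∑ v, ∑ w, (if v < w then m v w else 0) *
        ((if v = p then (1 : ℤ) else 0) * (if w = q then (1 : ℤ) else 0) -
          (if w = p then (1 : ℤ) else 0) * (if v = q then (1 : ℤ) else 0))) =
      (if p < q then m p q else 0) - (if q < p then m q p else 0) := by
  simp [mul_sub, Finset.sum_sub_distrib, mul_comm]

/-- Pushing a homomorphism through a pair product. [folklore] -/
private theorem pp_map {G H : Type*} [Group G] [Group H] {n : ℕ} (ψ : G →* H)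
    (c : Fin n → Fin n → G) (e : Fin n → Fin n → ℤ) :
    ψ ((List.finRange n).map (fun v => ((List.finRange n).map (fun w =>
      if v < w then c v w ^ (e v w) else 1)).prod)).prod =
    ((List.finRange n).map (fun v => ((List.finRange n).map (fun w =>
      if v < w then ψ (c v w) ^ (e v w) else 1)).prod)).prod := by
  simp only [map_list_prod, List.map_map, Function.comp_def]
  refine congrArg List.prod (List.map_congr_left fun v _ => congrArg List.prod
    (List.map_congr_left fun w _ => ?_))
  split_ifs <;> simp

/-- A product of pointwise products splits when the second factors are central. [folklore] -/
private theorem prod_map_mul_of_central {G ι : Type*} [Group G] (l : List ι) (f g : ι → G)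
    (hg : ∀ i, g i ∈ center G) :
    (l.map fun i => f i * g i).prod = (l.map f).prod * (l.map g).prod := by
  induction l with
  | nil => simp
  | cons i l ih =>
    have h := mem_center_iff.mp (hg i) (l.map f).prod
    simp only [List.map_cons, List.prod_cons, ih, mul_assoc]
    congr 1
    rw [← mul_assoc, ← h, mul_assoc]

/-- Pair products of central elements are additive in the exponents. [folklore] -/
private theorem pp_add {G : Type*} [Group G] {n : ℕ} (c : Fin n → Fin n → G)
    (hc : ∀ v w, c v w ∈ center G) (e e' : Fin n → Fin n → ℤ) :
    ((List.finRange n).map (fun v => ((List.finRange n).map (fun w =>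
      if v < w then c v w ^ (e v w + e' v w) else 1)).prod)).prod =
    ((List.finRange n).map (fun v => ((List.finRange n).map (fun w =>
      if v < w then c v w ^ (e v w) else 1)).prod)).prod *
    ((List.finRange n).map (fun v => ((List.finRange n).map (fun w =>
      if v < w then c v w ^ (e' v w) else 1)).prod)).prod := by
  have hcen : ∀ (e : Fin n → Fin n → ℤ) v w, (if v < w then c v w ^ (e v w) else (1 : G)) ∈ center G :=
    fun e v w => by split_ifs; exacts [zpow_mem (hc v w) _, one_mem _]
  rw [← prod_map_mul_of_central _ _ _ fun v => list_prod_mem (List.forall_mem_map.2 fun w _ => hcen e' v w)]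
  refine congrArg List.prod (List.map_congr_left fun v _ => ?_)
  rw [← prod_map_mul_of_central _ _ _ fun w => hcen e' v w]
  refine congrArg List.prod (List.map_congr_left fun w _ => ?_)
  split_ifs; exacts [zpow_add _ _ _, (mul_one _).symm]

/-- A pair product with a single exponent `1` at `(v₀, w₀)`, `v₀ < w₀`, is `c v₀ w₀`. [folklore] -/
private theorem pp_single {G : Type*} [Group G] {n : ℕ} (c : Fin n → Fin n → G) {v₀ w₀ : Fin n}
    (h : v₀ < w₀) :
    ((List.finRange n).map (fun v => ((List.finRange n).map (fun w =>
      if v < w then c v w ^ (if v = v₀ ∧ w = w₀ then (1 : ℤ) else 0) else 1)).prod)).prod =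
    c v₀ w₀ := by
  rw [List.prod_map_eq_pow_single v₀ _ fun v hv _ =>
    List.prod_eq_one (List.forall_mem_map.2 fun w _ => by simp [hv])]
  rw [List.count_finRange, pow_one, List.prod_map_eq_pow_single w₀ _ fun w hw _ => by simp [hw]]
  simp [h]

/-- A multiplicative predicate true on the `⁅y_v, b⁆` is true on `⁅a, b⁆` (central case). [folklore] -/
private theorem comm_left_induction {Q : Type*} [Group Q] {n : ℕ}
    (hQ : ∀ a b : Q, ⁅a, b⁆ ∈ center Q) (π : FreeGroup (Fin n) →* Q) (R : Q → Prop) (h1 : R 1)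
    (hmul : ∀ x y, R x → R y → R (x * y)) (hinv : ∀ x, R x → R x⁻¹) (b : Q)
    (hb : ∀ v, R ⁅π (FreeGroup.of v), b⁆) (a : FreeGroup (Fin n)) : R ⁅π a, b⁆ := by
  have hm : ∀ a a' : Q, ⁅a * a', b⁆ = ⁅a, b⁆ * ⁅a', b⁆ := fun a a' => by
    have h := mem_center_iff.mp (hQ a' b)
    rw [commutatorElement_mul_left_eq_conj_mul, h a, mul_inv_cancel_right, h ⁅a, b⁆]
  induction a with
  | C1 => rwa [map_one, commutatorElement_one_left]
  | of v => exact hb v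
  | inv_of v ih =>
    rw [map_inv, eq_inv_of_mul_eq_one_left (by rw [← hm, inv_mul_cancel, commutatorElement_one_left] :
      ⁅(π (FreeGroup.of v))⁻¹, b⁆ * ⁅π (FreeGroup.of v), b⁆ = 1)]
    exact hinv _ ih
  | mul x y hx hy => rw [map_mul, hm]; exact hmul _ _ hx hy

/-- **Degree-2 generation**: every element of `γ₂ F` is a pair product modulo `γ₃ F`. [folklore] -/
private theorem gen_two {n : ℕ} {η : FreeGroup (Fin n)}
    (hη : η ∈ (⊤ : Subgroup (FreeGroup (Fin n))).lowerCentralSeries 1) :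
    ∃ m : Fin n → Fin n → ℤ, η * (((List.finRange n).map (fun v => ((List.finRange n).map (fun w =>
      if v < w then ⁅(FreeGroup.of v : FreeGroup (Fin n)), FreeGroup.of w⁆ ^ (m v w)
      else (1 : FreeGroup (Fin n)))).prod)).prod)⁻¹ ∈
      (⊤ : Subgroup (FreeGroup (Fin n))).lowerCentralSeries 2 := by
  set N := (⊤ : Subgroup (FreeGroup (Fin n))).lowerCentralSeries 2 with hN
  set π : FreeGroup (Fin n) →* FreeGroup (Fin n) ⧸ N := QuotientGroup.mk' N with hπ
  -- commutators are central in `F ⧸ γ₃ F`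
  have hQ : ∀ a b : FreeGroup (Fin n) ⧸ N, ⁅a, b⁆ ∈ center _ := by
    have h1 : ((⊤ : Subgroup (FreeGroup (Fin n))).map π).lowerCentralSeries 2 = ⊥ := by
      rw [← map_lowerCentralSeries, ← hN, hπ, QuotientGroup.map_mk'_self]
    rw [← MonoidHom.range_eq_map, hπ, QuotientGroup.range_mk'] at h1
    exact fun a b => commutator_top_right_eq_bot_iff_le_center.mp h1
      (commutator_mem_commutator (mem_top a) (mem_top b))
  have hc : ∀ v w : Fin n, π ⁅FreeGroup.of v, FreeGroup.of w⁆ ∈ center _ := fun v w => by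
    simpa only [map_commutatorElement] using hQ _ _
  -- the predicate "is a pair product in `F ⧸ γ₃ F`" is multiplicative and holds on commutators
  set R : FreeGroup (Fin n) ⧸ N → Prop := fun q => ∃ m : Fin n → Fin n → ℤ,
    q = ((List.finRange n).map (fun v => ((List.finRange n).map (fun w =>
      if v < w then π ⁅FreeGroup.of v, FreeGroup.of w⁆ ^ (m v w) else 1)).prod)).prod with hR
  have R1 : R 1 := ⟨fun _ _ => 0, by simp⟩
  have Rmul : ∀ x y, R x → R y → R (x * y) := fun x y ⟨m, hm⟩ ⟨m', hm'⟩ =>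
    ⟨fun v w => m v w + m' v w, by rw [hm, hm', ← pp_add _ hc]⟩
  have Rinv : ∀ x, R x → R x⁻¹ := fun x ⟨m, hm⟩ => ⟨fun v w => -m v w, by
    rw [hm]; refine (eq_inv_of_mul_eq_one_left ?_).symm
    rw [← pp_add _ hc]; simp⟩
  have Rvw : ∀ v w : Fin n, R ⁅π (FreeGroup.of v), π (FreeGroup.of w)⁆ := fun v w => by
    rcases lt_trichotomy v w with hvw | rfl | hwv
    · exact ⟨fun v' w' => if v' = v ∧ w' = w then 1 else 0, by rw [pp_single _ hvw, map_commutatorElement]⟩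
    · rw [commutatorElement_self]; exact R1
    · rw [← commutatorElement_inv]
      exact Rinv _ ⟨fun v' w' => if v' = w ∧ w' = v then 1 else 0, by rw [pp_single _ hwv, map_commutatorElement]⟩
  have key : ∀ a b : FreeGroup (Fin n), R ⁅π a, π b⁆ := fun a b =>
    comm_left_induction hQ π R R1 Rmul Rinv (π b) (fun v => by
      rw [← commutatorElement_inv]
      exact Rinv _ (comm_left_induction hQ π R R1 Rmul Rinv _ (fun w => Rvw w v) b)) a
  have main : R (π η) := by
    rw [Subgroup.mem_lowerCentralSeries_succ_iff] at hη
    induction hη using closure_induction with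
    | mem x hx => obtain ⟨p, -, q, -, rfl⟩ := hx; rw [map_commutatorElement]; exact key p q
    | one => rw [map_one]; exact R1
    | mul x y _ _ hx hy => rw [map_mul]; exact Rmul _ _ hx hy
    | inv x _ hx => rw [map_inv]; exact Rinv _ hx
  obtain ⟨m, hm⟩ := main
  rw [← pp_map] at hm
  exact ⟨m, by rw [← div_eq_mul_inv, ← QuotientGroup.eq_iff_div_mem]; exact hm⟩

/-- **Magnus–Witt reading in degrees `≤ 3`** (registered stub `stub_magnusWittRead`):
degree-2 Magnus injectivity `INJ2` and the reading lemma `READ` for `FreeGroup (Fin n)`, see the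
module docstring. [folklore] -/
theorem stub_magnusWittRead : (∀ (n : ℕ) (e : Fin n → Fin n → ℤ), ((List.finRange n).map (fun v => ((List.finRange n).map (fun w => if v < w then ⁅(FreeGroup.of v : FreeGroup (Fin n)), FreeGroup.of w⁆ ^ (e v w) else (1 : FreeGroup (Fin n)))).prod)).prod ∈ (⊤ : Subgroup (FreeGroup (Fin n))).lowerCentralSeries 2 → ∀ v w : Fin n, v < w → e v w = 0) ∧ (∀ (n : ℕ) (s : Fin n → ℤ) (η : Fin n → FreeGroup (Fin n)), (∀ j, s j = 1 ∨ s j = -1) → (∀ j, η j ∈ (⊤ : Subgroup (FreeGroup (Fin n))).lowerCentralSeries 1) → ((List.finRange n).map (fun j => ⁅(η j)⁻¹, FreeGroup.of j⁆ ^ (s j))).prod ∈ (⊤ : Subgroup (FreeGroup (Fin n))).lowerCentralSeries 3 → ∃ D : Fin n → Fin n → Fin n → ℤ, (∀ a b c, D b a c = -D a b c) ∧ (∀ a b c, D a c b = -D a b c) ∧ ∀ j, η j * (((List.finRange n).map (fun v => ((List.finRange n).map (fun w => if v < w then ⁅(FreeGroup.of v : FreeGroup (Fin n)), FreeGroup.of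 w⁆ ^ (s j * D j v w) else (1 : FreeGroup (Fin n)))).prod)).prod)⁻¹ ∈ (⊤ : Subgroup (FreeGroup (Fin n))).lowerCentralSeries 2) := by
  refine ⟨fun n e he v w hvw => ?_, fun n s η hs hη hW => ?_⟩
  · -- INJ2: read the `(0,2)` entry of `y_v ↦ 1 + E₁₂`, `y_w ↦ 1 + E₂₃`
    obtain ⟨φ, hφ, hφ'⟩ := rep_exists (fun i => if i = v then (1 : ℤ) else 0)
      (fun i => if i = w then (1 : ℤ) else 0) (fun _ => 0)
    obtain ⟨c, hc⟩ := lcs_two_shape φ hφ' he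
    obtain ⟨c', hc'⟩ := pp_shape φ _ _ _ hφ e
    rw [omega_delta] at hc'
    simpa [hvw, lt_asymm hvw] using (congrFun (congrFun (hc.symm.trans hc') 0) 2).symm
  · -- READ: degree-2 coordinates `m j` of the `η j`, antisymmetrised to `M j`; `D j = s j • M j`
    choose m hm using fun j => gen_two (hη j)
    obtain ⟨M, hM⟩ : ∃ M : Fin n → Fin n → Fin n → ℤ, ∀ j v w,
        M j v w = (if v < w then m j v w else 0) - (if w < v then m j w v else 0) :=
      ⟨_, fun _ _ _ => rfl⟩
    -- the cyclic identities, read by `y_p ↦ 1 + E₁₂`, `y_q ↦ 1 + E₂₃`, `y_r ↦ 1 + E₃₄`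
    have cyc : ∀ p q r : Fin n, s p * M p q r = s r * M r p q := fun p q r => by
      obtain ⟨φ, hφ, hφ'⟩ := rep_exists (fun i => if i = p then (1 : ℤ) else 0)
        (fun i => if i = q then (1 : ℤ) else 0) (fun i => if i = r then (1 : ℤ) else 0)
      have hηj : ∀ j, ∃ c : ℤ, (φ (η j)).val =
          !![1, 0, M j p q, c; 0, 1, 0, M j q r; 0, 0, 1, 0; 0, 0, 0, (1 : ℤ)] := fun j => by
        obtain ⟨c', hc'⟩ := pp_shape φ _ _ _ hφ (m j)
        rw [omega_delta, omega_delta, ← hM, ← hM] at hc'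
        obtain ⟨c, hc⟩ := lcs_two_shape φ hφ' (hm j)
        rw [map_mul, map_inv, Units.val_mul, Units.mul_inv_eq_iff_eq_mul, hc'] at hc
        exact ⟨c + c', by rw [hc, umul]; exact uext (by ring) (by ring) (by ring) (by ring) (by ring) (by ring)⟩
      have hcj : ∀ j, (φ (⁅(η j)⁻¹, FreeGroup.of j⁆ ^ (s j))).val =
          !![1, 0, 0, s j * ((if j = p then (1 : ℤ) else 0) * M j q r -
            M j p q * (if j = r then (1 : ℤ) else 0)); 0, 1, 0, 0; 0, 0, 1, 0; 0, 0, 0, (1 : ℤ)] := fun j => by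
        obtain ⟨c, hc⟩ := hηj j
        rw [map_zpow, map_commutatorElement, map_inv]
        rcases hs j with h | h <;> rw [h]
        · rw [zpow_one, ucinv hc (hφ j)]; exact uext rfl rfl (by ring) rfl rfl rfl
        · rw [zpow_neg_one, uinv (ucinv hc (hφ j))]; exact uext (by ring) (by ring) (by ring) rfl (by ring) rfl
      have hW' := prod_corner φ _ _ (List.finRange n) fun j _ => hcj j
      rw [lcs_three_shape φ hφ' hW, Units.val_one, uone] at hW'
      have h03 := congrFun (congrFun hW' 0) 3
      simp only [Matrix.of_apply, Matrix.cons_val', Matrix.cons_val_zero, Matrix.cons_val, ← Fin.sum_univ_def] at h03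
      simp [mul_sub, Finset.sum_sub_distrib, mul_comm] at h03; linarith
    refine ⟨fun j v w => s j * M j v w, fun a b c => ?_, fun a b c => ?_, fun j => ?_⟩
    · dsimp only
      rw [← cyc a c b, hM a c b, hM a b c]; ring
    · dsimp only
      rw [hM a c b, hM a b c]; ring
    · have key : ∀ v w, (if v < w then ⁅(FreeGroup.of v : FreeGroup (Fin n)), FreeGroup.of w⁆ ^
          (s j * (s j * M j v w)) else (1 : FreeGroup (Fin n))) =
          if v < w then ⁅FreeGroup.of v, FreeGroup.of w⁆ ^ (m j v w) else 1 := fun v w => by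
        split_ifs with hvw
        · rw [hM, if_pos hvw, if_neg (lt_asymm hvw), sub_zero]; rcases hs j with h | h <;> simp [h]
        · rfl
      simpa only [key] using hm j

end Summit.SmoothPoincare4.SmoothPoincare4.Theorems.NilpotentShadowsStandard.SaturatedTorsorDescent
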